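import Summits.CriticalPhenomena.PercolationContinuityZ3.Theorems.PercNearOneGluingNoHeavyQuantGatedSliceMixLawQRouting
import HarnessLib

/-!
# QUANT lane R8, T-DEC, leg (III), blob case — `LawDec.GatedSliceMixLaw'`, the Q-ALONE side: **MIDS ABSORB ⟹ DEC** — if the low `k₁` of
# `Q = zδ₀ + (1−z)·slice {k₁,k₂;λ} a g` fits into its compatible MIDS (own twin `k₁+a` and/or the top `k₂`), the zero is automatically
# affordable (mean identity + `usage·(m−t) ≤ t−k₁` + top-affordability): pieces 1–2 of the mids-first routing need NO class inequality

builds on p205010 (kernel theorem, internal audit signed; external expert review pending)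

Support file (`--supports stmt-CriticalPhenomena-4575`), QUANT lane seat prim-quant-arm-1 (gen 41), rung R8 of
`run/shared/lean/prim/quant/LADDER.md`.  Theorems only, standard axioms, no sorries, no definitions.  Corollary file of
`…QuantGatedSliceMixLawQRouting` (this seat: `mixLawQ_decAtT_of_routing`); memo `run/shared/lean/prim/quant/prim-quant-arm-1-g41/Q-ALONE-G41.md` §4(i).

THE LEMMA.  Frame of the node, `1 ≤ k₁ ≤ j`, `2k₁ < t`, `k₁+a` and `k₂` not `t`-lows, `k₂ + a ≥ j+1`.  If `x_P + x_K = A = (1−z)(1−λ)(1−g)` with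
`x_P, x_K ≥ 0`, `usage(k₁, k₁+a)·x_P ≤ B`, `usage(k₁, k₂)·x_K ≤ C`, and each POSITIVE amount goes to a COMPATIBLE MID (`x_P > 0 ⟹ k₁+a ≤ j ∧ t < k₁+(k₁+a)`,
`x_K > 0 ⟹ k₂ ≤ j ∧ t < k₁+k₂`), then `Q` is `DECAtT y t j (M+a)`.  PROOF: `mixLawQ_decAtT_of_routing` with `x_G = 0`; its offer inequality
`t·z ≤ Σ_X κ(X)(mass X − usage·x_X)` follows TERMWISE from the mean identity `t·z = (k₁−t)A + (P−t)B + (K−t)C + (G−t)D` (pure algebra from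
`(1−z)(k₁+(k₂−k₁)λ) = S`): `(G−t)D ≤ t(1−y)/y·D` (`y(k₂+a) ≤ t`), and for a mid `X` carrying `x_X`: `(X−t)·mass − (t−k₁)x_X ≤ κ(X)(mass − usage·x_X)` by
`usage_mid_mul_le` when `X > t`, trivially when `X ≤ t`.  (Shipping `k₁` to a GIANT is not free — that is piece 3 of the memo, the class inequalities.)
EXACT CENSUS (`work/explore/qpiece.py`): pieces 1–2 are ≈ 80 % of the regime-R instances of the classes `{m,M}×{m,M,G}`.
HONEST STATUS: `GatedSliceMixLaw'` (regime R), CW, `GateMove`, `GatedConvEmptyFree`, `SingleGateConvClosed`, `TreeDEC`, `FarTreeRow` OPEN;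
RATE class log\* / honest sentence of `run/shared/lean/prim/quant/README.md` unchanged.

* **`LawDec.mixLawQ_decAtT_of_midsAbsorb`**, `LawDec.gatedSliceMixLaw'_of_midsAbsorb`.

[this work]; rates: prim-quant-stmt g22–g26 (`usage_mid_mul_le`); node: prim-quant-stmt g29 (this lane).  Nothing here is cited as a published
result.  The gluing rows served [cite: KozmaNitzan2024, Conjecture 3 (p. 15)]; product measure [cite: Grimmett1999, §1.3 p. 10].
-/

noncomputable section

namespace Summit.CriticalPhenomena.PercolationContinuityZ3.Theorems

namespace Quant

open Finset

/-- the two-point law `{lo, hi; g}` (as in `…QuantLawDEC`) -/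
local notation3 "TP[" lo ", " hi ", " g ", " h "]" =>
  (g : ℝ) * (if (h : ℕ) = (hi : ℕ) then (1 : ℝ) else 0) + (1 - (g : ℝ)) * (if (h : ℕ) = (lo : ℕ) then (1 : ℝ) else 0)

namespace LawDec

/-- **MIDS ABSORB ⟹ `Q` IS DEC** (pieces 1–2 of the mids-first routing; see the file header). [this work] -/
theorem mixLawQ_decAtT_of_midsAbsorb (y z g S lam : ℝ) (a j M k₁ k₂ : ℕ) (xP xK : ℝ)
    (hy0 : 0 < y) (hy1 : y < 1) (hz0 : 0 ≤ z) (hz1 : z < 1) (hg1 : g ≤ 1) (hyg : y ≤ (1 - z) * g) (ha : 1 ≤ a)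
    (hta : y * (M : ℝ) ≤ S) (hk : k₁ ≤ k₂) (hk₂M : k₂ ≤ M) (hlam0 : 0 ≤ lam) (hlam1 : lam ≤ 1)
    (hmean : (1 - z) * ((k₁ : ℝ) + ((k₂ : ℝ) - k₁) * lam) = S)
    (hk₁ : 1 ≤ k₁) (hk₁j : k₁ ≤ j) (hk₁low : 2 * (k₁ : ℝ) < S + (a : ℝ) * g * (1 - z))
    (hP : S + (a : ℝ) * g * (1 - z) ≤ 2 * ((k₁ + a : ℕ) : ℝ) ∨ j < k₁ + a)
    (hK : S + (a : ℝ) * g * (1 - z) ≤ 2 * (k₂ : ℝ) ∨ j < k₂)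
    (hG : j + 1 ≤ k₂ + a)
    (hxP0 : 0 ≤ xP) (hxK0 : 0 ≤ xK) (hsplit : xP + xK = (1 - z) * (1 - lam) * (1 - g))
    (hPcomp : 0 < xP → (k₁ + a ≤ j ∧ S + (a : ℝ) * g * (1 - z) < (k₁ : ℝ) + ((k₁ + a : ℕ) : ℝ)))
    (hKcomp : 0 < xK → (k₂ ≤ j ∧ S + (a : ℝ) * g * (1 - z) < (k₁ : ℝ) + (k₂ : ℝ)))
    (hcapP : usage y (S + (a : ℝ) * g * (1 - z)) j k₁ (k₁ + a) * xP ≤ (1 - z) * (1 - lam) * g)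
    (hcapK : usage y (S + (a : ℝ) * g * (1 - z)) j k₁ k₂ * xK ≤ (1 - z) * lam * (1 - g)) :
    DECAtT y (S + (a : ℝ) * g * (1 - z)) j (M + a)
      (fun p => z * (if p = 0 then (1 : ℝ) else 0) + (1 - z) * slice (fun q => TP[k₁, k₂, lam, q]) a g p) := by
  set t : ℝ := S + (a : ℝ) * g * (1 - z) with ht
  set A : ℝ := (1 - z) * (1 - lam) * (1 - g) with hA
  set B : ℝ := (1 - z) * (1 - lam) * g with hB
  set C : ℝ := (1 - z) * lam * (1 - g) with hC
  set D : ℝ := (1 - z) * lam * g with hD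
  have hg0 : 0 < g := by
    by_contra hc
    have : (1 - z) * g ≤ 0 := mul_nonpos_of_nonneg_of_nonpos (by linarith) (not_lt.1 hc)
    linarith
  have h1z : 0 < 1 - z := by linarith
  have h1y : 0 < 1 - y := by linarith
  have hB0 : 0 ≤ B := mul_nonneg (mul_nonneg h1z.le (by linarith)) hg0.le
  have hC0 : 0 ≤ C := mul_nonneg (mul_nonneg h1z.le hlam0) (by linarith)
  have hD0 : 0 ≤ D := mul_nonneg (mul_nonneg h1z.le hlam0) hg0.le
  have hk₁r : (1 : ℝ) ≤ k₁ := by exact_mod_cast hk₁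
  -- mass and mean of the five atoms (pure algebra)
  have hmass : z + A + B + C + D = 1 := by rw [hA, hB, hC, hD]; ring
  have hmom : (k₁ : ℝ) * A + ((k₁ + a : ℕ) : ℝ) * B + (k₂ : ℝ) * C + ((k₂ + a : ℕ) : ℝ) * D = t := by
    rw [hA, hB, hC, hD, ht, ← hmean]; push_cast; ring
  -- top-affordability at every position `≤ M + a`
  have htaX : ∀ X : ℕ, X ≤ M + a → y * (X : ℝ) ≤ t := by
    intro X hX
    have hh : (X : ℝ) ≤ (M : ℝ) + a := by exact_mod_cast hX
    have h1 : y * (X : ℝ) ≤ y * (M : ℝ) + y * a := by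
      calc y * (X : ℝ) ≤ y * ((M : ℝ) + a) := mul_le_mul_of_nonneg_left hh hy0.le
        _ = y * (M : ℝ) + y * a := by ring
    have h3 : y * (a : ℝ) ≤ (a : ℝ) * g * (1 - z) := by
      calc y * (a : ℝ) ≤ (1 - z) * g * (a : ℝ) := mul_le_mul_of_nonneg_right hyg (Nat.cast_nonneg a)
        _ = (a : ℝ) * g * (1 - z) := by ring
    rw [ht]; linarith
  -- the termwise bounds
  -- (G): `(G − t)·D ≤ t(1−y)/y·D`
  have hGterm : (((k₂ + a : ℕ) : ℝ) - t) * D ≤ t * (1 - y) / y * (D - usage y t j k₁ (k₂ + a) * 0) := by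
    rw [mul_zero, sub_zero]
    have hyG : y * ((k₂ + a : ℕ) : ℝ) ≤ t := htaX (k₂ + a) (by omega)
    have hcoef : (((k₂ + a : ℕ) : ℝ) - t) ≤ t * (1 - y) / y := by
      rw [le_div_iff₀ hy0]; nlinarith
    exact mul_le_mul_of_nonneg_right hcoef hD0
  -- a mid `X` carrying `x` from `k₁`
  have hMidterm : ∀ (X : ℕ) (mass x : ℝ), 0 ≤ mass → 0 ≤ x → usage y t j k₁ X * x ≤ mass →
      (0 < x → (X ≤ j ∧ t < (k₁ : ℝ) + X)) → (t ≤ 2 * (X : ℝ) ∨ j < X) → X ≤ M + a →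
      ((X : ℝ) - t) * mass - (t - k₁) * x
        ≤ (if j + 1 ≤ X then t * (1 - y) / y else if t < (X : ℝ) then (X : ℝ) - t else 0) * (mass - usage y t j k₁ X * x) := by
    intro X mass x hm0 hx0 hcap hcomp habs hXM
    by_cases hgi : j + 1 ≤ X
    · -- a giant: then `x = 0` (positive amounts go to mids only)
      have hx : x = 0 := by
        rcases hx0.eq_or_lt with h0 | hpos
        · exact h0.symm
        · exact absurd (hcomp hpos).1 (by omega)
      rw [if_pos hgi, hx, mul_zero, mul_zero, sub_zero, sub_zero]
      have hcoef : ((X : ℝ) - t) ≤ t * (1 - y) / y := by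
        rw [le_div_iff₀ hy0]; nlinarith [htaX X hXM]
      exact mul_le_mul_of_nonneg_right hcoef hm0
    · rw [if_neg hgi]
      by_cases hXt : t < (X : ℝ)
      · rw [if_pos hXt]
        -- `usage·(X − t) ≤ t − k₁` when charged
        rcases hx0.eq_or_lt with h0 | hpos
        · rw [← h0]; simp
        · obtain ⟨hXj, hcmp⟩ := hcomp hpos
          have hu := usage_mid_mul_le y t j k₁ X hy0 hy1 hk₁low hXj hcmp (htaX X hXM)
          have h2 := mul_le_mul_of_nonneg_right hu hx0
          have e : ((X : ℝ) - t) * (mass - usage y t j k₁ X * x)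
              = ((X : ℝ) - t) * mass - usage y t j k₁ X * ((X : ℝ) - t) * x := by ring
          rw [e]
          linarith [h2]
      · rw [if_neg hXt, zero_mul]
        have h1 : ((X : ℝ) - t) * mass ≤ 0 := mul_nonpos_of_nonpos_of_nonneg (by linarith) hm0
        have h2 : 0 ≤ (t - k₁) * x := mul_nonneg (by linarith) hx0
        linarith
  refine mixLawQ_decAtT_of_routing y z g S lam a j M k₁ k₂ xP xK 0 hy0 hy1 hz0 hz1 hg1 hyg ha hta hk hk₂M hlam0 hlam1 hmean
    hk₁ hk₁j hk₁low hP hK hG hxP0 hxK0 le_rfl (by rw [add_zero]; exact hsplit)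
    (fun h => Or.inr (hPcomp h).2) (fun h => Or.inr (hKcomp h).2) hcapP hcapK (by rw [mul_zero]; exact hD0) ?_
  -- the offer inequality, termwise
  have hPt := hMidterm (k₁ + a) B xP hB0 hxP0 hcapP hPcomp hP (by omega)
  have hKt := hMidterm k₂ C xK hC0 hxK0 hcapK hKcomp hK (by omega)
  have htz : t * z = ((k₁ : ℝ) - t) * A + (((k₁ + a : ℕ) : ℝ) - t) * B + ((k₂ : ℝ) - t) * C + (((k₂ + a : ℕ) : ℝ) - t) * D := by
    have e1 : t * z = t * (1 - A - B - C - D) := by rw [← hmass]; ring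
    rw [e1]; linarith [hmom]
  have hAterm : ((k₁ : ℝ) - t) * A = -((t - k₁) * xP) - (t - k₁) * xK := by rw [← hsplit]; ring
  rw [htz, hAterm]
  linarith [hPt, hKt, hGterm]

/-- **`GatedSliceMixLaw'` with θ = 0 when the mids absorb the low `k₁`.** [this work] -/
theorem gatedSliceMixLaw'_of_midsAbsorb (y z g S lam : ℝ) (a j M h k₁ k₂ : ℕ) (xP xK : ℝ)
    (hy0 : 0 < y) (hy1 : y < 1) (hz0 : 0 ≤ z) (hz1 : z < 1) (hg1 : g ≤ 1) (hyg : y ≤ (1 - z) * g) (ha : 1 ≤ a)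
    (hta : y * (M : ℝ) ≤ S) (hk : k₁ ≤ k₂) (hk₂M : k₂ ≤ M) (hlam0 : 0 ≤ lam) (hlam1 : lam ≤ 1)
    (hmean : (1 - z) * ((k₁ : ℝ) + ((k₂ : ℝ) - k₁) * lam) = S)
    (hk₁ : 1 ≤ k₁) (hk₁j : k₁ ≤ j) (hk₁low : 2 * (k₁ : ℝ) < S + (a : ℝ) * g * (1 - z))
    (hP : S + (a : ℝ) * g * (1 - z) ≤ 2 * ((k₁ + a : ℕ) : ℝ) ∨ j < k₁ + a)
    (hK : S + (a : ℝ) * g * (1 - z) ≤ 2 * (k₂ : ℝ) ∨ j < k₂)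
    (hG : j + 1 ≤ k₂ + a)
    (hxP0 : 0 ≤ xP) (hxK0 : 0 ≤ xK) (hsplit : xP + xK = (1 - z) * (1 - lam) * (1 - g))
    (hPcomp : 0 < xP → (k₁ + a ≤ j ∧ S + (a : ℝ) * g * (1 - z) < (k₁ : ℝ) + ((k₁ + a : ℕ) : ℝ)))
    (hKcomp : 0 < xK → (k₂ ≤ j ∧ S + (a : ℝ) * g * (1 - z) < (k₁ : ℝ) + (k₂ : ℝ)))
    (hcapP : usage y (S + (a : ℝ) * g * (1 - z)) j k₁ (k₁ + a) * xP ≤ (1 - z) * (1 - lam) * g)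
    (hcapK : usage y (S + (a : ℝ) * g * (1 - z)) j k₁ k₂ * xK ≤ (1 - z) * lam * (1 - g)) :
    ∃ θ : ℝ, 0 ≤ θ ∧ θ < 1 ∧
      DECAtT y (S + (a : ℝ) * g * (1 - z)) j (M + a)
        (fun p => θ * weakMidLaw S g h a p
          + (1 - θ) * (z * (if p = 0 then (1 : ℝ) else 0) + (1 - z) * slice (fun q => TP[k₁, k₂, lam, q]) a g p)) := by
  refine ⟨0, le_rfl, zero_lt_one, ?_⟩
  refine decAtT_congr (fun p => ?_)
    (mixLawQ_decAtT_of_midsAbsorb y z g S lam a j M k₁ k₂ xP xK hy0 hy1 hz0 hz1 hg1 hyg ha hta hk hk₂M hlam0 hlam1 hmean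
      hk₁ hk₁j hk₁low hP hK hG hxP0 hxK0 hsplit hPcomp hKcomp hcapP hcapK)
  ring

end LawDec

end Quant

end Summit.CriticalPhenomena.PercolationContinuityZ3.Theorems
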